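import Mathlib
import Summits.BirchSwinnertonDyer.BirchSwinnertonDyer.Theorems.ResidualThetaTransportAtTwoResidualSignedLambdaLowerCMAtTwoStationRCoeffEmbeddings
import HarnessLib

/-!
# Station (R) step D′ kit (vanishing half): a SEPARATING family of functionals (CoordNondeg) that kills the twisted coordinate values kills the
# `ι`-recombined value (`separating_of_coordNondeg`, `recombinedValue_eq_zero_of_coordValues_eq_zero`), and the recombinator rides in the
# `u ≠ 0` slot of (R) (`stationR_of_socket_at_scaled_multiplier`, `stationR_of_relay_at_scaled_multiplier`)

Route `ResidualThetaTransportAtTwo` (RTT), crux RSL_g `ResidualSignedLambdaLowerCMAtTwo` (stmt-BirchSwinnertonDyer-22608), line «onepair» v3g,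
registered KERNEL stub `stub_kzgValueRelation` = station (R) — its load-bearing STEP D′ `π.cvec z ≠ 0` for a Kato valued class (STUB-PLAN rev 29,
S155/T90; port lane of the (R) writer `prover-bsd-wall-tp2-p2x-w3` g18, who consumes this file by name). Width seat `prover-bsd-wall-tp2-p2x-w2` g22
(`--supports 22608 --as helper`, closes nothing). THEOREMS ONLY (no `def`, no instance, no notation, no named fact, no `sorry`). BSD is NOT proved by
any of this; 22608 / 26074 / 24105 stay OPEN / HOLD; nothing here asserts child A / child B / (R).

PORT of the kernel-checked sketch `Cruxes/ResidualThetaCountLowerPureAtTwo/Sketch_sidea_k3_g26.lean`'s successor `Sketch_sidea_k2_g29.lean` (stub-ideation k2 g29,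
«PLAN B»; STUB-PLAN rev 29 row 106 PASS), §D (generic: `sum_embed_mul_eq_zero_of_dual`, `span_eq_top_of_separating`, `sum_embed_mul_eq_zero_of_separating`,
`stationR_of_socket_at_scaled_multiplier`, `stationR_of_relay_at_scaled_multiplier`) and §D′ (at the tree's `𝒪 = padicCoeffIntegers S ⊂ K = padicCoeffField S ⊂ ℚ̄_p → ℂ_p`:
`separating_of_coordNondeg`, `recombinedValue_eq_zero_of_coordValues_eq_zero`, over w3's R1 `StationR.exists_pow_smul_mem_padicCoeffIntegers` p721448),
statements and proofs VERBATIM up to the namespace (§E PLAN C Galois is not ported); credit: stub-ideation k2 g29 (every statement and proof).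

References: [Kato2004Asterisque] Thm. 12.5 (1) (pp. 221–222), §13.8; [Lang1990] Ch. 6 §5 (Artin–Dedekind independence of characters); [Washington1997] §13.2.
-/

set_option autoImplicit false
-- the Theorems namespace of this sub repeats the summit name by design (D-0017 nested layout)
set_option linter.dupNamespace false

open scoped BigOperators

namespace Summit.BirchSwinnertonDyer.BirchSwinnertonDyer.Theorems.ThetaTransport.StationRSeparating

/-! ## §D. PLAN B — CoordNondeg kills the recombined value; the recombinator rides in the `u`-slot -/

section PlanBGeneric

variable {F K L I N : Type*} [Field F] [Field K] [Algebra F K] [FiniteDimensional F K] [Field L] [Fintype N]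

/-- If EVERY `F`-functional kills the twisted values, the `ι`-recombined value vanishes (expand `b_l` in an `F`-basis). -/
theorem sum_embed_mul_eq_zero_of_dual (φ₀ : F →+* L) (ι : K →+* L) (hc : ∀ x : F, ι (algebraMap F K x) = φ₀ x)
    (b : N → K) (W : N → L) (h : ∀ φ : Module.Dual F K, ∑ l, φ₀ (φ (b l)) * W l = 0) :
    ∑ l, ι (b l) * W l = 0 := by
  classical
  let β := Module.finBasis F K
  have hb : ∀ l, ι (b l) = ∑ k, φ₀ (β.coord k (b l)) * ι (β k) := by
    intro l
    conv_lhs => rw [← β.sum_repr (b l)]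
    simp only [map_sum, Algebra.smul_def, map_mul, hc]
    rfl
  calc ∑ l, ι (b l) * W l = ∑ l, ∑ k, φ₀ (β.coord k (b l)) * ι (β k) * W l := by
        simp only [hb, Finset.sum_mul]
    _ = ∑ k, ι (β k) * ∑ l, φ₀ (β.coord k (b l)) * W l := by
        rw [Finset.sum_comm]
        refine Finset.sum_congr rfl fun k _ => ?_
        rw [Finset.mul_sum]
        exact Finset.sum_congr rfl fun l _ => by ring
    _ = 0 := by
        refine Finset.sum_eq_zero fun k _ => ?_
        rw [h (β.coord k), mul_zero]

/-- A jointly injective (= SEPARATING, `CoordNondeg`) family of functionals spans the dual (finite dimension). -/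
theorem span_eq_top_of_separating (t : I → Module.Dual F K) (ht : Function.Injective (fun (y : K) (i : I) => t i y)) :
    Submodule.span F (Set.range t) = ⊤ := by
  classical
  set W := Submodule.span F (Set.range t) with hW
  have hco : W.dualCoannihilator = ⊥ := by
    rw [Submodule.eq_bot_iff]
    intro y hy
    rw [Submodule.mem_dualCoannihilator] at hy
    have : (fun i => t i y) = fun i => t i 0 := by
      funext i
      rw [hy (t i) (Submodule.subset_span ⟨i, rfl⟩), map_zero]
    exact ht this
  have := Subspace.dualCoannihilator_dualAnnihilator_eq (W := W)
  rw [hco, Submodule.dualAnnihilator_bot] at this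
  exact this.symm

/-- **PLAN B algebraic core**: a separating family (CoordNondeg: `y ↦ (t_i y)_i` injective) that kills the twisted values kills the
`ι`-recombined value `Σ_l ι(b_l) W_l` — pure `F`-linear algebra, no embeddings, no Galois. -/
theorem sum_embed_mul_eq_zero_of_separating [Fintype I] (φ₀ : F →+* L) (ι : K →+* L) (hc : ∀ x : F, ι (algebraMap F K x) = φ₀ x)
    (t : I → Module.Dual F K) (ht : Function.Injective (fun (y : K) (i : I) => t i y))
    (b : N → K) (W : N → L) (h : ∀ i, ∑ l, φ₀ (t i (b l)) * W l = 0) :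
    ∑ l, ι (b l) * W l = 0 := by
  classical
  refine sum_embed_mul_eq_zero_of_dual φ₀ ι hc b W fun φ => ?_
  have hφ : φ ∈ Submodule.span F (Set.range t) := by
    rw [span_eq_top_of_separating t ht]; exact Submodule.mem_top
  obtain ⟨coef, hcoef⟩ := (Submodule.mem_span_range_iff_exists_fun F).mp hφ
  rw [← hcoef]
  simp only [LinearMap.coe_sum, Finset.sum_apply, LinearMap.smul_apply, smul_eq_mul, map_sum, map_mul,
    Finset.sum_mul]
  rw [Finset.sum_comm]
  refine Finset.sum_eq_zero fun i _ => ?_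
  have : ∑ l, φ₀ (coef i) * φ₀ (t i (b l)) * W l = φ₀ (coef i) * ∑ l, φ₀ (t i (b l)) * W l := by
    rw [Finset.mul_sum]; exact Finset.sum_congr rfl fun l _ => by ring
  rw [this, h i, mul_zero]

/-- **PLAN B move, evaluation road**: the socket is generic in its multiplier, so feed it at `μ′ := r · μt` (`r` KNOWN NONZERO, not known
to be a unit) and re-associate `r` into station (R)'s `u ≠ 0` slot.  `P μ′` abbreviates the socket's value hypothesis (EV-C) at `μ′`. -/
theorem stationR_of_socket_at_scaled_multiplier {Λ O : Type*} [CommRing Λ] [IsDomain Λ] [Zero O]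
    (C : O → Λ) (E μt Lm r : Λ) (P : Λ → Prop)
    (hsock : ∀ μ' : Λ, μ' ≠ 0 → P μ' → ∃ (ν : O) (v : Λ), ν ≠ 0 ∧ v ≠ 0 ∧ C ν * E = μ' * (Lm * v))
    (hμ : μt ≠ 0) (hr : r ≠ 0) (hP : P (r * μt)) :
    ∃ (ν : O) (u : Λ), ν ≠ 0 ∧ u ≠ 0 ∧ C ν * E = μt * (Lm * u) := by
  obtain ⟨ν, v, hν, hv, h⟩ := hsock (r * μt) (mul_ne_zero hr hμ) hP
  exact ⟨ν, r * v, hν, mul_ne_zero hr hv, by rw [h]; ring⟩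

/-- **PLAN B move, congruence road** (`RelayDescends.relay_descends` applied at `μt ↦ r · μt` returns `C ν · w · E = C u₀ · (r·μt) · L⁻` with the
E-side unit `w` (T86) and `C u₀ ≠ 0`): divide by the unit, re-associate — (R) with `u := C u₀ · r · w⁻¹ ≠ 0`. -/
theorem stationR_of_relay_at_scaled_multiplier {Λ : Type*} [CommRing Λ] [IsDomain Λ] {Cν Cu₀ w E μt Lm r : Λ}
    (hw : IsUnit w) (hCu : Cu₀ ≠ 0) (hr : r ≠ 0) (h : Cν * w * E = Cu₀ * (r * μt) * Lm) :
    ∃ u : Λ, u ≠ 0 ∧ Cν * E = μt * (Lm * u) := by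
  obtain ⟨wu, rfl⟩ := hw
  refine ⟨Cu₀ * r * ↑wu⁻¹, mul_ne_zero (mul_ne_zero hCu hr) (Units.ne_zero _), ?_⟩
  calc Cν * E = ↑wu⁻¹ * (Cν * ↑wu * E) := by
        rw [show Cν * ↑wu * E = ↑wu * (Cν * E) by ring, Units.inv_mul_cancel_left]
    _ = ↑wu⁻¹ * (Cu₀ * (r * μt) * Lm) := by rw [h]
    _ = μt * (Lm * (Cu₀ * r * ↑wu⁻¹)) := by ring

end PlanBGeneric

/-! ### §D′. PLAN B at the tree's types: `𝒪 = padicCoeffIntegers S ⊂ K = padicCoeffField S ⊂ ℚ̄_p → ℂ_p` -/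

section PlanBPadic

open Literature.NumberTheory.EllipticCurves
open Summit.BirchSwinnertonDyer.BirchSwinnertonDyer.Theorems.ThetaTransport.StationR

variable {p : ℕ} [Fact p.Prime] (S : Set (PadicAlgCl p))

/-- **CoordNondeg on `𝒪` ⟹ separating on `K`.**  If `a ↦ (t₀(c′_i a))_i` is injective on `𝒪` (`OnePairPins.CoordNondeg π c′`), then the
`ℚ_p`-linear extension `t` of `t₀` (w3 R1 `exists_linearMap_extend`) gives a jointly injective family `y ↦ (t(c′_i y))_i` on `K = 𝒪[1/p]`. -/
theorem separating_of_coordNondeg {n : ℕ} (t₀ : padicCoeffIntegers S →+ ℤ_[p])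
    (t : padicCoeffField S →ₗ[ℚ_[p]] ℚ_[p]) (ht : ∀ a, t (padicCoeffIntegers.toField S a) = (t₀ a : ℚ_[p]))
    (c' : Fin n → padicCoeffIntegers S)
    (hnd : Function.Injective (fun (a : padicCoeffIntegers S) (i : Fin n) => t₀ (c' i * a))) :
    Function.Injective (fun (y : padicCoeffField S) (i : Fin n) =>
      (t.comp (LinearMap.mulLeft ℚ_[p] (padicCoeffIntegers.toField S (c' i)))) y) := by
  have hp0 : (p : ℚ_[p]) ≠ 0 := Nat.cast_ne_zero.mpr (Fact.out : p.Prime).ne_zero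
  intro y₁ y₂ hy
  rw [← sub_eq_zero]
  set y := y₁ - y₂ with hydef
  have hy0 : ∀ i, t (padicCoeffIntegers.toField S (c' i) * y) = 0 := by
    intro i
    have := congrFun hy i
    simp only [LinearMap.comp_apply, LinearMap.mulLeft_apply] at this
    rw [hydef, mul_sub, map_sub, this, sub_self]
  obtain ⟨a, ha⟩ := exists_pow_smul_mem_padicCoeffIntegers S y
  set A : padicCoeffIntegers S := ⟨_, ha⟩ with hAdef
  have hA : padicCoeffIntegers.toField S A = (p : ℚ_[p]) ^ a • y := coe_toField_mk_pow_smul S y a ha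
  have hAi : ∀ i, t₀ (c' i * A) = 0 := by
    intro i
    have h1 : ((t₀ (c' i * A) : ℤ_[p]) : ℚ_[p]) = 0 := by
      rw [← ht, map_mul, hA, mul_smul_comm, map_smul, hy0 i, smul_zero]
    exact Subtype.ext (by rw [PadicInt.coe_zero]; exact h1)
  have hA0 : A = 0 := by
    apply hnd
    funext i
    simp only [hAi, mul_zero, map_zero]
  have : (p : ℚ_[p]) ^ a • y = 0 := by
    rw [← hA, hA0, map_zero]
  exact (smul_eq_zero.mp this).resolve_left (pow_ne_zero _ hp0)

/-- **The recombined value dies with the coordinate values** (B2's algebraic step, tree-typed): if the `t₀`-twisted coordinate values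
`Σ_l t₀(c′_i bO_l) · W_l` vanish for every `i` and `c′` is CoordNondeg, then (VALρ)'s `bO`-recombined value `Σ_l bO_l · W_l` vanishes in `ℂ_p`. -/
theorem recombinedValue_eq_zero_of_coordValues_eq_zero [FiniteDimensional ℚ_[p] (padicCoeffField S)] {n nb : ℕ}
    (t₀ : padicCoeffIntegers S →+ ℤ_[p])
    (t : padicCoeffField S →ₗ[ℚ_[p]] ℚ_[p]) (ht : ∀ a, t (padicCoeffIntegers.toField S a) = (t₀ a : ℚ_[p]))
    (c' : Fin n → padicCoeffIntegers S)
    (hnd : Function.Injective (fun (a : padicCoeffIntegers S) (i : Fin n) => t₀ (c' i * a)))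
    (bO : Fin nb → padicCoeffIntegers S) (W : Fin nb → ℂ_[p])
    (h : ∀ i, ∑ l, algebraMap ℚ_[p] ℂ_[p] (t₀ (c' i * bO l) : ℚ_[p]) * W l = 0) :
    ∑ l, algebraMap (PadicAlgCl p) ℂ_[p] (bO l : PadicAlgCl p) * W l = 0 := by
  have hsep := separating_of_coordNondeg S t₀ t ht c' hnd
  have hc : ∀ x : ℚ_[p], ((algebraMap (PadicAlgCl p) ℂ_[p]).comp
      ((padicCoeffField S).val : padicCoeffField S →+* PadicAlgCl p)) (algebraMap ℚ_[p] (padicCoeffField S) x) =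
        algebraMap ℚ_[p] ℂ_[p] x := by
    intro x
    rw [IsScalarTower.algebraMap_apply ℚ_[p] (PadicAlgCl p) ℂ_[p] x]
    simp only [RingHom.coe_comp, Function.comp_apply]
    rfl
  have key := sum_embed_mul_eq_zero_of_separating (algebraMap ℚ_[p] ℂ_[p])
    ((algebraMap (PadicAlgCl p) ℂ_[p]).comp ((padicCoeffField S).val : padicCoeffField S →+* PadicAlgCl p)) hc
    (fun i => t.comp (LinearMap.mulLeft ℚ_[p] (padicCoeffIntegers.toField S (c' i)))) hsep
    (fun l => padicCoeffIntegers.toField S (bO l)) W (fun i => by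
      simp only [LinearMap.comp_apply, LinearMap.mulLeft_apply]
      refine Eq.trans (Finset.sum_congr rfl fun l _ => ?_) (h i)
      rw [← map_mul, ht])
  have key' : ∑ l, algebraMap (PadicAlgCl p) ℂ_[p] ((padicCoeffIntegers.toField S (bO l) : padicCoeffField S) : PadicAlgCl p) * W l = 0 := by
    simpa using key
  calc ∑ l, algebraMap (PadicAlgCl p) ℂ_[p] (bO l : PadicAlgCl p) * W l
      = ∑ l, algebraMap (PadicAlgCl p) ℂ_[p] ((padicCoeffIntegers.toField S (bO l) : padicCoeffField S) : PadicAlgCl p) * W l := rfl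
    _ = 0 := key'

end PlanBPadic

end Summit.BirchSwinnertonDyer.BirchSwinnertonDyer.Theorems.ThetaTransport.StationRSeparating
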